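import Summits.Ventures.PercRepro.S1CoreCapEightFourAll

/-!
# PercRepro — THE EXACT VALUE `Q*(8) = 23`: FOUR BIG LINES (p1, gen 29)

Case (B) of the instance with its own constant: `S1CoreCapEightFourAll` proves `FourBigBound₈` (stated with
`25`) from `four_big_bound_of_no_triangle` (`16`) and `four_big_bound_of_triangle` (`23`); this module states the
same proof with the conclusion `≤ 23` (`four_big_bound_sharp`), the form the exact assembly `S1CoreCapEightExact`
needs. `proofs/P1-S4-CAPBRIDGE.md` §21. Axioms: standard.
-/

namespace PercRepro

namespace S1

namespace FourCap

namespace Eight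

open Seven

variable {β : Type} [DecidableEq β]

/-- **Four distinct big lines at nullity `8` give cap sum `≤ 23`** — the proof of `fourBigBound₈_holds` with
its own constant (`four_big_bound_of_no_triangle` gives `16`, `four_big_bound_of_triangle` gives `23`). -/
theorem four_big_bound_sharp :
    ∀ (β : Type) [DecidableEq β] (w : β → ℕ) (ls : Finset (Finset β)),
    (∀ L ∈ ls, ∀ v ∈ L, w v = 1 ∨ w v = 2) →
    (∀ L ∈ ls, 3 ≤ L.card ∧ wsum w L ≤ 5) →
    (∀ L ∈ ls, ∀ L' ∈ ls, L ≠ L' → (L ∩ L').card ≤ 1) →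
    (∀ l : List (Finset β), l.Nodup → (∀ L ∈ l, L ∈ ls) → wsum w (unionL l) ≤ 8 + lineRank l) →
    (∀ l : List (Finset β), l.Nodup → (∀ L ∈ l, L ∈ ls) → lineRank l ≤ 3 → (unionL l).card ≤ 9) →
    (∀ l : List (Finset β), l.Nodup → (∀ L ∈ l, L ∈ ls) → lineRank l ≤ 4 → (unionL l).card ≤ 20) →
    ∀ L₁ L₂ L₃ L₄ : Finset β, L₁ ∈ ls → L₂ ∈ ls → L₃ ∈ ls → L₄ ∈ ls →
      L₂ ≠ L₁ → L₃ ≠ L₁ → L₄ ≠ L₁ → L₃ ≠ L₂ → L₄ ≠ L₂ → L₄ ≠ L₃ →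
      4 ≤ L₁.card → 4 ≤ L₂.card → 4 ≤ L₃.card → 4 ≤ L₄.card →
      ∑ L ∈ ls, capPaper L.card (fat w L) ≤ 23 := by
  intro β _ w ls h1 h2 h3 h4 h5 h6 L₁ L₂ L₃ L₄ hL₁ hL₂ hL₃ hL₄ h12 h13 h14 h23 h24 h34 c1 c2 c3 c4
  -- no fifth big line
  have hrest : ∀ L ∈ ls, L ≠ L₁ → L ≠ L₂ → L ≠ L₃ → L ≠ L₄ → L.card = 3 := by
    intro L hL n1 n2 n3 n4
    have := (h2 L hL).1
    by_contra hne
    exact not_five_big h1 h2 h3 h4 h5 hL₁ hL₂ hL₃ hL₄ hL h12 h13 h14 n1 h23 h24 n2 h34 n3 n4 c1 c2 c3 c4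
      (by omega)
  by_cases hnt : NoTriangle ls
  · exact (four_big_bound_of_no_triangle h1 h2 h3 h4 h5 hnt hL₁ hL₂ hL₃ hL₄ h12 h13 h14 h23 h24 h34 c1 c2 c3
      c4 hrest).trans (by norm_num)
  · -- a triangle `M, N, O`
    unfold NoTriangle at hnt
    push Not at hnt
    obtain ⟨M, N, O, hM, hN, hO, cM, cN, cO, hNM, hOM, hON, hNM1, hO2⟩ := hnt
    have hNM' := h3 N hN M hM hNM
    have hO' : (O ∩ (N ∪ M)).card ≤ 2 := le_trans (card_inter_union_le O N M)
      (by have := h3 O hO N hN hON; have := h3 O hO M hM hOM; omega)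
    have hr : lineRank [O, N, M] ≤ 3 := lineRank_le_three_of_triangle cN cO (by omega) (by omega) hO'
    -- every big line is one of the four
    have hbig : ∀ L ∈ ls, 4 ≤ L.card → L = L₁ ∨ L = L₂ ∨ L = L₃ ∨ L = L₄ := by
      intro L hL hc
      by_contra hne
      simp only [not_or] at hne
      have := hrest L hL hne.1 hne.2.1 hne.2.2.1 hne.2.2.2
      omega
    -- the fourth line `D`
    have hMin : M ∈ ({L₁, L₂, L₃, L₄} : Finset (Finset β)) := by
      simp only [Finset.mem_insert, Finset.mem_singleton]; exact hbig M hM cM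
    have hNin : N ∈ ({L₁, L₂, L₃, L₄} : Finset (Finset β)) := by
      simp only [Finset.mem_insert, Finset.mem_singleton]; exact hbig N hN cN
    have hOin : O ∈ ({L₁, L₂, L₃, L₄} : Finset (Finset β)) := by
      simp only [Finset.mem_insert, Finset.mem_singleton]; exact hbig O hO cO
    have hcard4 : ({L₁, L₂, L₃, L₄} : Finset (Finset β)).card = 4 := by
      rw [Finset.card_insert_of_notMem (by simp [h12.symm, h13.symm, h14.symm]),
        Finset.card_insert_of_notMem (by simp [h23.symm, h24.symm]), Finset.card_pair h34.symm]
    have hcard3 : ({M, N, O} : Finset (Finset β)).card = 3 := by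
      rw [Finset.card_insert_of_notMem (by simp [hNM.symm, hOM.symm]), Finset.card_pair hON.symm]
    have hsub3 : ({M, N, O} : Finset (Finset β)) ⊆ {L₁, L₂, L₃, L₄} := by
      intro L hL
      simp only [Finset.mem_insert, Finset.mem_singleton] at hL
      rcases hL with rfl | rfl | rfl
      · exact hMin
      · exact hNin
      · exact hOin
    obtain ⟨D, hDin, hDnot⟩ : ∃ D ∈ ({L₁, L₂, L₃, L₄} : Finset (Finset β)), D ∉ ({M, N, O} : Finset (Finset β)) := by
      by_contra hc
      push Not at hc
      have := Finset.card_le_card (fun L hL => hc L hL : ({L₁, L₂, L₃, L₄} : Finset (Finset β)) ⊆ {M, N, O})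
      omega
    simp only [Finset.mem_insert, Finset.mem_singleton, not_or] at hDnot
    obtain ⟨hDM, hDN, hDO⟩ := hDnot
    have hD : D ∈ ls := by
      simp only [Finset.mem_insert, Finset.mem_singleton] at hDin
      rcases hDin with rfl | rfl | rfl | rfl <;> assumption
    have cD : 4 ≤ D.card := by
      simp only [Finset.mem_insert, Finset.mem_singleton] at hDin
      rcases hDin with rfl | rfl | rfl | rfl <;> assumption
    -- the other lines have three points
    have hrest' : ∀ L ∈ ls, L ≠ M → L ≠ N → L ≠ O → L ≠ D → L.card = 3 := by
      intro L hL nM nN nO nD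
      have h4set : ({M, N, O, D} : Finset (Finset β)) = {L₁, L₂, L₃, L₄} := by
        apply Finset.eq_of_subset_of_card_le
        · intro L' hL'
          simp only [Finset.mem_insert, Finset.mem_singleton] at hL'
          rcases hL' with rfl | rfl | rfl | rfl
          · exact hMin
          · exact hNin
          · exact hOin
          · exact hDin
        · rw [hcard4, Finset.card_insert_of_notMem (by simp [hNM.symm, hOM.symm, Ne.symm hDM]),
            Finset.card_insert_of_notMem (by simp [hON.symm, Ne.symm hDN]),
            Finset.card_pair (Ne.symm hDO)]
      by_contra hne
      have hLbig : L ∈ ({L₁, L₂, L₃, L₄} : Finset (Finset β)) := by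
        simp only [Finset.mem_insert, Finset.mem_singleton]
        exact hbig L hL (by have := (h2 L hL).1; omega)
      rw [← h4set] at hLbig
      simp only [Finset.mem_insert, Finset.mem_singleton] at hLbig
      rcases hLbig with rfl | rfl | rfl | rfl
      · exact nM rfl
      · exact nN rfl
      · exact nO rfl
      · exact nD rfl
    exact (four_big_bound_of_triangle h1 h2 h3 h4 h5 hM hN hO hD hNM hOM hDM hON hDN hDO cM cN cO cD hrest'
      hr).trans (by norm_num)

end Eight

end FourCap

end S1

end PercRepro
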